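import Summits.QuantumFields.BalabanUV.T4Continuum.Support.MinimalActionCompact
import Summits.QuantumFields.BalabanUV.T4Continuum.Support.SmoothRefineOfApprox
import Mathlib.Topology.Order.Compact
import HarnessLib

/-!
# T⁴ programme, node NE3 (η-rate of the minimisers) — THE ACTION SANDWICH, supplier A-H1-cpt, part 2:
# EXISTENCE OF MINIMISERS BY COMPACTNESS, and (H1) ⇐ (H2) — END-A for the small-field class without the binder (H1)

NE3 formalisation swarm `b2b-balaban-t4-ne3-formalise-*` of the cell `pub-balaban`, unit `b2b-balaban-t4-ne3-formalise-leaf-05`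
(gen 2), supplier node «A-H1-cpt» under leaf A-H1 of the owner's skeleton `t4/b2b-balaban-t4-ne3-p1/SKELETON-NE3-P1.md`
v1.2 §3 (journal INTENT 2026-08-20T07:43Z).  Part 1 (`MinimalActionCompact`) supplied: the small-field class
`MinimalActionRate.sfClass d L N ε k` is COMPACT and the `k`-fold average (43) is CONTINUOUS on it for `ε` in the regime of
B7 Prop. 2.  Here:
§6 `isCompact_admissible` and **`exists_isMinimiser_of_nonempty`**: every run `k` whose admissible set
   `MinimalActionSandwich.admissible (sfClass d L N ε) L k V` is non-empty HAS A MINIMISER (`IsCompact.exists_isMinOn` on the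
   continuous `levelAction`) — leaf A-H1 modulo non-emptiness, with NO regularity, NO printed statement, NO bound on `N, k`;
§7 **`exists_isMinimiser_of_refine`**: (H1) ⇐ `V ∈ sfClass d L N ε 0` ∧ (H2)-existence (every minimiser of run `k` is the
   rescaled one-step average of SOME configuration of the class at level `k+1` — the first two conjuncts of
   `SandwichData.refine`), by induction on the level (`mem_admissible_succ`); hence **`sandwichData_sfClass_of_refine`** and
   **`actionRate_sfClass_of_refine`** = `MinimalActionRate.sandwichData_sfClass` / `actionRate_sfClass` WITHOUT their binder
   `h1`, concluding `T4EtaRateMin.ActionRate (minActReadings …) (wallConstNA(d,L)·(g + b³)/L²) ((L²)⁻¹)` LITERALLY through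
   `actionRate_of_sandwichData` BY NAME.
WHAT THIS CHANGES IN THE ROW'S DAG (`t4/formal/NE3/DAG.md` v1.2): leaf A-H1 («[dict] → S3, printed TYPE B11 Thm 1 (8)») is
KERNEL modulo (H2); route (A)'s END therefore rests on (H3)/(H3ˢᵘᵖ) [B11 Thm 1 TYPE regularity of the minimisers], (H0)
[trivial, `LevelZeroRegular`] and the kinematic refinement [`SmoothRefine` ⇐ `ApproxRefine`, crew rows R1 + owner's R2/R0]
ALONE; existence holds in `sfClass (ε)` for EVERY radius `ε` of the regime (no margin question for EXISTENCE; only the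
REGULARITY of our minimisers remains a Thm-1 reading, cf. leaf-06's finding, journal 2026-08-20T07:27:58Z).

HONEST FRAMING.  Finite-T⁴ bookkeeping about MINIMISERS of the constrained Wilson action (rung (B)+1: the finite-torus
continuum limit of gauge-invariant observables — NOT infinite volume, NO mass gap, NOT the Clay problem, NOT summit
progress).  **NE3 is NOT proved**: (H3) and (H2) remain hypothesis SHAPES, asserted for nothing; NE3-(A) stays CONDITIONAL
on ⟨(H3ˢᵘᵖ), (H0), the kinematic refinement⟩.  No conditional of the cell (`BetaPertH`, (B), G-an2-4) occurs; nothing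
printed is a hypothesis; `IsMinimiser`/`admissible`/`sfClass`/`SandwichData`/`Regular` imported BY NAME, never restated;
no `def`, no `sorry`.  Context: T. Bałaban, Commun. Math. Phys. **102** (1985) 277–309 [Balaban1985Variational] (5)–(8)
p. 278, Thm 1 p. 279.  PLACEMENT: `Summits/QuantumFields/BalabanUV/` (human rule 2026-08-19).  Record:
`t4/formal/NE3/LEAVES.md`.  HONEST DEPENDENCY: continuum YM on T⁴ ⇐ BetaPertH ∧ nine spine estimates (0/9 proved);
BetaPertH ⇐ (D1) ∧ (D4) ∧ CAP+tail; G-an2-4 gates asym, D1 and NE2/3/4.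
-/

set_option autoImplicit false

open scoped BigOperators Matrix Matrix.Norms.L2Operator Topology
open NormedSpace Finset

namespace Summit.QuantumFields.BalabanUV.T4Continuum.MinimalActionExistence

open Literature.MathematicalPhysics.QuantumFieldTheory.Balaban1983to89
open B7Prop1Explicit B7Prop2Explicit MatrixLog UnitaryModel
open T4AveragingDeficitWall hiding Site Plane Plaq Bond
open T4AveragingDeficitWallBoundary (IsPeriodicCfg)
open T4AveragingDeficitNonAbelian (wallConstNA)
open T4EtaRateMin (ActionRate)
open MinimalActionLevels MinimalActionSandwich MinimalActionRate MinimalActionCompact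
open MinimalActionRefine ChainEndFix SmoothRefineOfApprox

noncomputable section

variable {d : ℕ} {n : Type*} [Fintype n] [DecidableEq n]

/-! ## §6 EXISTENCE OF MINIMISERS (leaf A-H1 modulo non-emptiness) -/

/-- **THE ADMISSIBLE SET OF RUN `k` IS COMPACT** (for the small-field class family, `ε` small): it is the intersection
of the compact class `sfClass d L N ε k` with the preimage of the datum under the `k`-fold average, continuous there.
[folklore] -/
theorem isCompact_admissible [Nonempty n] {L : ℕ} (hL : 2 ≤ L) {ε : ℝ} (hε0 : 0 ≤ ε)
    (hε1 : 16 * C0 d * ε ≤ 3) (hε2 : 1024 * (d + 1) * (d + 4) * (L : ℝ) ^ 2 * ε ≤ 1) (N k : ℕ)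
    (V : Site d → Fin d → (Matrix n n ℂ)ˣ) : IsCompact (admissible (sfClass d L N ε) L k V) := by
  have hcl : IsClosed (sfClass (n := n) d L N ε k) := (isCompact_sfClass (d := d) (n := n) L N ε k).isClosed
  have hcont : ContinuousOn (fun U : Site d → Fin d → (Matrix n n ℂ)ˣ => avgIter L U k) (sfClass d L N ε k) :=
    (continuousOn_avgIter hL hε0 hε1 hε2 k k le_rfl).mono fun U hU => ⟨hU.1, hU.2.2⟩
  have h : admissible (sfClass d L N ε) L k V
      = sfClass d L N ε k ∩ (fun U : Site d → Fin d → (Matrix n n ℂ)ˣ => avgIter L U k) ⁻¹' {V} := by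
    ext U; simp [admissible]
  rw [h]
  exact (isCompact_sfClass L N ε k).of_isClosed_subset (hcont.preimage_isClosed_of_isClosed hcl isClosed_singleton)
    Set.inter_subset_left

/-- **EXISTENCE OF A MINIMISER OF EVERY RUN WITH NON-EMPTY ADMISSIBLE SET** — leaf A-H1 of route (A) modulo
non-emptiness, by COMPACTNESS (Tychonoff over the bonds of `ℤ^d` × compactness of `U(N)`; closed periodicity, small-field
and average constraints; continuous Wilson action — the extreme value theorem `IsCompact.exists_isMinOn`).  Hypotheses:
`L ≥ 2` and the class radius `ε` small enough that every intermediate average stays inside the domain of the series (21)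
(`16·C₀·ε ≤ 3`, `1024(d+1)(d+4)L²ε ≤ 1`, explicit); NO regularity, NO printed statement, NO bound on `N` or `k`.
[folklore] -/
theorem exists_isMinimiser_of_nonempty [Nonempty n] {L : ℕ} (hL : 2 ≤ L) {ε : ℝ} (hε0 : 0 ≤ ε)
    (hε1 : 16 * C0 d * ε ≤ 3) (hε2 : 1024 * (d + 1) * (d + 4) * (L : ℝ) ^ 2 * ε ≤ 1) {N k : ℕ}
    {V : Site d → Fin d → (Matrix n n ℂ)ˣ} (hne : (admissible (sfClass d L N ε) L k V).Nonempty) :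
    ∃ U, IsMinimiser d (sfClass d L N ε) L N k V U := by
  obtain ⟨U, hU, hmin⟩ := (isCompact_admissible hL hε0 hε1 hε2 N k V).exists_isMinOn hne
    (continuous_levelAction (d := d) (n := n) L N k).continuousOn
  exact ⟨U, ⟨hU, fun U' hU' => hmin hU'⟩⟩

/-! ## §7 (H1) FROM (H2): minimisers exist at every level once every minimiser admits a refinement in the next class -/

/-- At level `0` the datum is the (only) admissible configuration, hence a minimiser, as soon as it lies in the class.
[folklore] -/
theorem exists_isMinimiser_zero {𝒞 : ℕ → Set (Site d → Fin d → (Matrix n n ℂ)ˣ)} {L N : ℕ}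
    {V : Site d → Fin d → (Matrix n n ℂ)ˣ} (hV : V ∈ 𝒞 0) : ∃ U, IsMinimiser d 𝒞 L N 0 V U :=
  ⟨V, ⟨⟨hV, rfl⟩, fun U' hU' => by rw [show U' = V from hU'.2]⟩⟩

/-- **(H1) ⇐ (H2)-existence, by induction on the level**: if the datum lies in the class at level `0` and every
minimiser of every run `k` is the rescaled one-step average of SOME configuration of the class at level `k+1` (the
first two conjuncts of `SandwichData.refine`; no regularity needed), then every run has a minimiser — the refinement
of the run-`k` minimiser is admissible for run `k+1` (`mem_admissible_succ`), so the admissible set is non-empty and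
§6 applies.  This removes (H1) from the independent hypotheses of END-A for the small-field class.
[folklore] -/
theorem exists_isMinimiser_of_refine [Nonempty n] {L : ℕ} (hL : 2 ≤ L) {ε : ℝ} (hε0 : 0 ≤ ε)
    (hε1 : 16 * C0 d * ε ≤ 3) (hε2 : 1024 * (d + 1) * (d + 4) * (L : ℝ) ^ 2 * ε ≤ 1) {N : ℕ}
    {V : Site d → Fin d → (Matrix n n ℂ)ˣ} (hV : V ∈ sfClass d L N ε 0)
    (h2 : ∀ (k : ℕ) (U : Site d → Fin d → (Matrix n n ℂ)ˣ), IsMinimiser d (sfClass d L N ε) L N k V U →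
      ∃ Ut, Ut ∈ sfClass d L N ε (k + 1) ∧ rescale L (bavg L Ut) = U) :
    ∀ k : ℕ, ∃ U, IsMinimiser d (sfClass d L N ε) L N k V U := by
  intro k
  induction k with
  | zero => exact exists_isMinimiser_zero hV
  | succ k ih =>
      obtain ⟨U, hU⟩ := ih
      obtain ⟨Ut, hUt, havg⟩ := h2 k U hU
      exact exists_isMinimiser_of_nonempty hL hε0 hε1 hε2 ⟨Ut, mem_admissible_succ hUt havg hU.mem⟩

/-- **`SandwichData` for the small-field class WITHOUT the existence hypothesis (H1)**: (H3) regularity of the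
minimisers + (H2) regular refinement (as in `MinimalActionRate.sandwichData_sfClass`) + the datum in the class at level
`0` + the smallness of `ε` of §6. [folklore] -/
theorem sandwichData_sfClass_of_refine [Nonempty n] {L N : ℕ} (hL : 2 ≤ L) {b g ε : ℝ} (hb : 0 ≤ b)
    (hbs : 512 * (d + 1) * (d + 4) * (L : ℝ) ^ 2 * b ≤ 1)
    (hbε : b + 226 * (8 * (d + 1) * (d + 4)) ^ 2 * b ^ 2 ≤ ε) (hε0 : 0 ≤ ε)
    (hε1 : 16 * C0 d * ε ≤ 3) (hε2 : 1024 * (d + 1) * (d + 4) * (L : ℝ) ^ 2 * ε ≤ 1)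
    {V : Site d → Fin d → (Matrix n n ℂ)ˣ} (hV : V ∈ sfClass d L N ε 0)
    (h3 : ∀ (k : ℕ) (U : Site d → Fin d → (Matrix n n ℂ)ˣ),
      IsMinimiser d (sfClass d L N ε) L N (k + 1) V U → Regular d L N b g (k + 1) U)
    (h2 : ∀ (k : ℕ) (U : Site d → Fin d → (Matrix n n ℂ)ˣ), IsMinimiser d (sfClass d L N ε) L N k V U →
      ∃ Ut, Ut ∈ sfClass d L N ε (k + 1) ∧ rescale L (bavg L Ut) = U ∧ Regular d L N b g (k + 1) Ut) :
    SandwichData d (sfClass d L N ε) L N b g V :=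
  sandwichData_sfClass (le_trans (by norm_num) hL) hb hbs hbε
    (exists_isMinimiser_of_refine hL hε0 hε1 hε2 hV fun k U hU => by
      obtain ⟨Ut, h1, h2', -⟩ := h2 k U hU
      exact ⟨Ut, h1, h2'⟩)
    h3 h2

/-- **END-A for the small-field class WITHOUT (H1)**: `T4EtaRateMin.ActionRate (minActReadings …) (wallConstNA(d,L)·(g + b³)/L²)
((L²)⁻¹)` for every domain `dom ⊆ sfClass d L N ε 0`, from (H3) + (H2) alone (`MinimalActionRate.actionRate_of_sandwichData`
BY NAME).  HONEST: (H3) and (H2) remain hypotheses (B11 Thm 1 TYPE regularity; the kinematic refinement); NE3 is NOT proved.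
[folklore] -/
theorem actionRate_sfClass_of_refine [Nonempty n] {L N : ℕ} (hL : 2 ≤ L) (hN : 1 ≤ N) {b g ε : ℝ} (hb : 0 ≤ b)
    (hbs : 512 * (d + 1) * (d + 4) * (L : ℝ) ^ 2 * b ≤ 1)
    (hbε : b + 226 * (8 * (d + 1) * (d + 4)) ^ 2 * b ^ 2 ≤ ε) (hε0 : 0 ≤ ε)
    (hε1 : 16 * C0 d * ε ≤ 3) (hε2 : 1024 * (d + 1) * (d + 4) * (L : ℝ) ^ 2 * ε ≤ 1)
    {dom : Set (Site d → Fin d → (Matrix n n ℂ)ˣ)} (hdom : dom ⊆ sfClass d L N ε 0)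
    (h3 : ∀ V ∈ dom, ∀ (k : ℕ) (U : Site d → Fin d → (Matrix n n ℂ)ˣ),
      IsMinimiser d (sfClass d L N ε) L N (k + 1) V U → Regular d L N b g (k + 1) U)
    (h2 : ∀ V ∈ dom, ∀ (k : ℕ) (U : Site d → Fin d → (Matrix n n ℂ)ˣ), IsMinimiser d (sfClass d L N ε) L N k V U →
      ∃ Ut, Ut ∈ sfClass d L N ε (k + 1) ∧ rescale L (bavg L Ut) = U ∧ Regular d L N b g (k + 1) Ut)
    {X : Type*} (loc : ℕ → (Site d → Fin d → (Matrix n n ℂ)ˣ) → X → ℝ) :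
    T4EtaRateMin.ActionRate (minActReadings d (sfClass d L N ε) L N dom loc)
      (T4AveragingDeficitNonAbelian.wallConstNA d L * (g + b ^ 3) / (L : ℝ) ^ 2) (((L : ℝ) ^ 2)⁻¹) :=
  actionRate_of_sandwichData (le_trans (by norm_num) hL) hN hb hbs
    (fun V hV => sandwichData_sfClass_of_refine hL hb hbs hbε hε0 hε1 hε2 (hdom hV) (h3 V hV) (h2 V hV)) loc

/-! ## §8 The owner's re-cut v1.1/v1.2 ENDs WITHOUT the binder (H1) -/

/-- A datum with sup-form regularity `(b, c)` at level `0` lies in the small-field class of every radius `ε ≥ b` at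
level `0`. [folklore] -/
theorem mem_sfClass_zero_of_regularSup {L N : ℕ} {b c ε : ℝ} (hbε : b ≤ ε)
    {V : Site d → Fin d → (Matrix n n ℂ)ˣ} (h0 : RegularSup d L N b c 0 V) : V ∈ sfClass d L N ε 0 :=
  ⟨h0.unitary, h0.periodic, MinimalActionRate.SmallField.mono h0.small (div_le_div_of_nonneg_right hbε (by positivity))⟩

/-- **(H1) FROM (H0) + (H3ˢᵘᵖ) + THE KINEMATIC LEMMA**: on the small-field class (radius `ε` in the regime of §6), a
datum with sup-form regularity `(b, c)`, `b ≤ ε`, whose minimisers of every run `k+1` have sup-form regularity `(b, c)`,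
has a minimiser at EVERY level as soon as `SmoothRefine (sfClass d L N ε) L N b c b′ c′` holds — the refinement of the
(regular) run-`k` minimiser makes run `k+1` admissible, and compactness does the rest. [folklore] -/
theorem exists_isMinimiser_of_smoothRefine [Nonempty n] {L N : ℕ} (hL : 2 ≤ L) {b c b' c' ε : ℝ} (hbε : b ≤ ε)
    (hε0 : 0 ≤ ε) (hε1 : 16 * C0 d * ε ≤ 3) (hε2 : 1024 * (d + 1) * (d + 4) * (L : ℝ) ^ 2 * ε ≤ 1)
    {V : Site d → Fin d → (Matrix n n ℂ)ˣ}
    (h3 : ∀ (k : ℕ) (U : Site d → Fin d → (Matrix n n ℂ)ˣ),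
      IsMinimiser d (sfClass d L N ε) L N (k + 1) V U → RegularSup d L N b c (k + 1) U)
    (h0 : RegularSup d L N b c 0 V) (hR : SmoothRefine d (sfClass (n := n) d L N ε) L N b c b' c') :
    ∀ k : ℕ, ∃ U, IsMinimiser d (sfClass d L N ε) L N k V U := by
  refine exists_isMinimiser_of_refine hL hε0 hε1 hε2 (mem_sfClass_zero_of_regularSup hbε h0) fun k U hU => ?_
  have hreg : RegularSup d L N b c k U := by
    cases k with
    | zero => exact regularSup_of_isMinimiser_zero h0 hU
    | succ k => exact h3 k U hU
  obtain ⟨Ut, hmem, havg, -⟩ := hR k U hU.mem.1 hreg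
  exact ⟨Ut, hmem, havg⟩

/-- **`MinimalActionRefine.actionRate_sfClass_of_smoothRefine` WITHOUT (H1)** (`L ≥ 2`, class radius `ε` in the regime of
§6 — `16·C₀·ε ≤ 3`, `1024(d+1)(d+4)L²ε ≤ 1`, explicit): `T4EtaRateMin.ActionRate` of the minimal actions at rate `L^{−2}`
from (H3ˢᵘᵖ) + (H0) + `SmoothRefine` ALONE.  NE3 is NOT proved: those three remain hypotheses. [folklore] -/
theorem actionRate_sfClass_of_smoothRefine_cpt [Nonempty n] {L N : ℕ} (hL : 2 ≤ L) (hN : 1 ≤ N) {b c b' c' ε : ℝ}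
    (hb : 0 ≤ b) (hBs : 512 * (d + 1) * (d + 4) * (L : ℝ) ^ 2 * max b b' ≤ 1)
    (hbε : b + 226 * (8 * (d + 1) * (d + 4)) ^ 2 * b ^ 2 ≤ ε)
    (hε1 : 16 * C0 d * ε ≤ 3) (hε2 : 1024 * (d + 1) * (d + 4) * (L : ℝ) ^ 2 * ε ≤ 1)
    {dom : Set (Site d → Fin d → (Matrix n n ℂ)ˣ)}
    (h3 : ∀ V ∈ dom, ∀ (k : ℕ) (U : Site d → Fin d → (Matrix n n ℂ)ˣ),
      IsMinimiser d (sfClass d L N ε) L N (k + 1) V U → RegularSup d L N b c (k + 1) U)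
    (h0 : ∀ V ∈ dom, RegularSup d L N b c 0 V)
    (hR : SmoothRefine d (sfClass (n := n) d L N ε) L N b c b' c')
    {X : Type*} (loc : ℕ → (Site d → Fin d → (Matrix n n ℂ)ˣ) → X → ℝ) :
    ActionRate (minActReadings d (sfClass d L N ε) L N dom loc)
      (wallConstNA d L * (gradConst d (max c c') + (max b b') ^ 3) / (L : ℝ) ^ 2) (((L : ℝ) ^ 2)⁻¹) := by
  have hbε' : b ≤ ε := by nlinarith
  have hε0 : 0 ≤ ε := hb.trans hbε'
  exact actionRate_sfClass_of_smoothRefine (le_trans (by norm_num) hL) hN hb hBs hbε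
    (fun V hV => exists_isMinimiser_of_smoothRefine hL hbε' hε0 hε1 hε2 (h3 V hV) (h0 V hV) hR) h3 h0 hR loc

/-- **`SmoothRefineOfApprox.actionRate_sfClass_of_approxRefine` (the owner's END of route (A), v1.2) WITHOUT (H1)**
(`L ≥ 2`, class radius `ε` in the regime of §6): the action-value η-rate from (H3ˢᵘᵖ) + (H0) + `ApproxRefine` (leaf R1)
ALONE.  NE3 is NOT proved: those three remain hypotheses; NE3-(A) is CONDITIONAL on ⟨(H3ˢᵘᵖ), (H0), ApproxRefine⟩.
[folklore] -/
theorem actionRate_sfClass_of_approxRefine_cpt [Nonempty n] {L N : ℕ} (hL : 2 ≤ L) (hN : 1 ≤ N)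
    {b c b₁ c₁ m ε : ℝ} (hb : 0 ≤ b) (hb₁ : 0 ≤ b₁) (hm : 0 ≤ m)
    (hBs : 512 * (d + 1) * (d + 4) * (L : ℝ) ^ 2 * max b (b₁ + 8 * m * (L : ℝ) ^ 3 / gap d L) ≤ 1)
    (hbε : b + 226 * (8 * (d + 1) * (d + 4)) ^ 2 * b ^ 2 ≤ ε)
    (hbs₁ : 512 * (d + 1) * (d + 4) * (L : ℝ) ^ 2 * b₁ ≤ 1)
    (hgap : 4 * (2 * (8 * (d + 1) * (d + 4) * (L : ℝ) ^ 2 * b₁) + 2 * m / gap d L) ≤ gap d L)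
    (hhalf : b₁ + 8 * m / gap d L ≤ 1 / 2) (hε : b₁ + 8 * m * (L : ℝ) ^ 3 / gap d L ≤ ε)
    (hε1 : 16 * C0 d * ε ≤ 3) (hε2 : 1024 * (d + 1) * (d + 4) * (L : ℝ) ^ 2 * ε ≤ 1)
    {dom : Set (Site d → Fin d → (Matrix n n ℂ)ˣ)}
    (h3 : ∀ V ∈ dom, ∀ (k : ℕ) (U : Site d → Fin d → (Matrix n n ℂ)ˣ),
      IsMinimiser d (sfClass d L N ε) L N (k + 1) V U → RegularSup d L N b c (k + 1) U)
    (h0 : ∀ V ∈ dom, RegularSup d L N b c 0 V)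
    (hA : ApproxRefine d (sfClass (n := n) d L N ε) L N b c b₁ c₁ m)
    {X : Type*} (loc : ℕ → (Site d → Fin d → (Matrix n n ℂ)ˣ) → X → ℝ) :
    ActionRate (minActReadings d (sfClass d L N ε) L N dom loc)
      (wallConstNA d L * (gradConst d (max c (c₁ + 36 * m * (L : ℝ) ^ 3 / gap d L))
        + (max b (b₁ + 8 * m * (L : ℝ) ^ 3 / gap d L)) ^ 3) / (L : ℝ) ^ 2) (((L : ℝ) ^ 2)⁻¹) :=
  actionRate_sfClass_of_smoothRefine_cpt hL hN hb hBs hbε hε1 hε2 h3 h0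
    (smoothRefine_of_approxRefine (le_trans (by norm_num) hL) hb₁ hm hbs₁ hgap hhalf hε hA) loc

end

end Summit.QuantumFields.BalabanUV.T4Continuum.MinimalActionExistence
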